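import Summits.HodgeConjecture.HodgeConjecture.Theorems.HLiu418E2LevelFinite
import Literature.RepresentationTheory.FixedPointsTraceAverage
import Mathlib.Analysis.InnerProductSpace.Projection.FiniteDimensional
import Mathlib.Topology.Algebra.OpenSubgroup
import HarnessLib

/-!
# Crux `HLiu418`, K-lane E1′₂ (collapse road) — HAND L: the class map of a space of cone forms, LEVEL FINITENESS from the frame
# hypotheses, and «the `K`-fixed vectors of the closure of the classes are classes of `K`-fixed forms»

Cell `hodgecm-mathlib`, FLOOR 0, programme P5 (`F0_AlbCm`); crux item `stmt-HodgeConjecture-24832` (`HCCMUnconditional.HLiu418`);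
seat A-p02 (g19), HAND L of the pen's deal `F0/P5/p02/DEAL-KE1prime-collapse.v1.F0P5p02g3.md` §L (F0P5-p02 (g3); v1.2: L = A-p02),
`--supports stmt-HodgeConjecture-24832` (helper).  THEOREMS ONLY — no definition, no instance, no notation, no named-fact hypothesis,
no `sorry`.  Generic rank-2 unitary datum `U(J)`, `J ∈ M₂(E)`, ONE complex place `w₁`, a cone frame `𝔣`, compact automorphic quotient.

The K-E1′₂ collapse road proves the P5 letter `Rogawski1990.curveCohFinComponentUnique_hol` from `Rogawski1990.curveMultiplicityLeOne`
alone (pen's census `F0/P5/p02/CENSUS-KE1prime-collapse.v0.F0P5p02g3.md`, step 3 «σ is realised in Hol(P)»).  This file supplies: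

* §1 **(L0) `exists_clsMapN`** — for a subspace `N ≤ holCotForms₂ … 𝔣` the CLASS MAP `Λ : N → L²`, `f ↦ [toQuotFun f]`, is linear, INJECTIVE
  (★ `toLp_toQuotFun_ne_zero`: continuous representatives, measure positive on opens) and intertwines `rightRep₂` with the regular
  representation (★ `toLp_toQuotFun_mul_right`); pattern ★ `E2Bootstrap.exists_clsMap₂`.
* §2 **(L1) `finite_holCotForms₂_inf_fixedPoints_of_frame`** — LEVEL FINITENESS from the FRAME hypotheses `hvt, hr, hvv` only (no
  hermitian binder; contrast ★ `finite_holCotForms₂_inf_fixedPoints`): for an OPEN `K ≤ U(J)(𝔸_{F,f})` the `K`-fixed cone-holomorphic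
  cotangent forms are finite-dimensional — `f ↦ toQuotFun f ∈ C(X)` is injective (★ `apply_eq_toQuotFun`) and its unit ball lies in the
  totally bounded family ★ `E2LevelFinite.totallyBounded_levelForms` (equicontinuity + Arzelà–Ascoli), so Riesz
  (`FiniteDimensional.of_totallyBounded_nhds_zero`) applies; verbatim pattern of ★ `E2LevelFinite.finite_fixedPoints_of_equivariant`.
* §3 **(L2) `exists_eq_clsMap_of_mem_closure_of_fixed`** — for `N` stable under `rightRep₂`, an open COMPACT `K` and a `K`-FIXED vector `y`
  in the CLOSURE of `Λ(N)`: `y = Λ f` for some `K`-fixed `f ∈ N`.  Proof: `M := Λ(N ∩ Fix K)` is finite-dimensional (L1), hence closed with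
  an orthogonal projection; `y₂ := y − pr_M y` is `K`-fixed (every vector of `M` is `K`-fixed, so `pr_M` commutes with `R(1,K)` by unitarity — the (H2) fact of ★ `E1pHilbert`, inlined as the
  private `starProjection_comm_of_forall_fixed` to keep this file's imports inside the built cone),
  lies in the closure, and is ORTHOGONAL to every `Λ h`, `h ∈ N`, by FINITE AVERAGING: `A h := n⁻¹ Σᵢ R_{tᵢ} h ∈ N ∩ Fix K` over a transversal
  of `K ∕ (K ∩ Stab h)` (★ `Literature.RepresentationTheory.exists_average_family`; the stabiliser is open by clause (Sm), of finite index in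
  the compact `K`), and `⟪Λ (A h), y₂⟫ = ⟪Λ h, y₂⟫` by unitarity (`tᵢ ∈ K` fixes `y₂`) while `Λ (A h) ∈ M ⊥ y₂`; so `y₂ ⊥ closure Λ(N) ∋ y₂`,
  `y₂ = 0`, `y = pr_M y ∈ Λ(N ∩ Fix K)`.
HONEST LABEL: HC_CM is proved only modulo the 7 printed citations (+ declared floor-0 debt) until rung 0 closes; this file discharges
none of them.

## References
* [Borel1997] A. Borel, *Automorphic forms on SL₂(ℝ)* (1997), §8 (finite dimensionality of automorphic forms of a given type on a compact
  quotient).  [BorelJacquet1979] A. Borel, H. Jacquet, Corvallis PSPM 33.1 (1979), §4.2 (smoothness, `K`-finiteness), §4.6 (`L²`).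
* [Bump1997] D. Bump, *Automorphic Forms and Representations* (1997), §4.2 Eq. (2.8) (the projector `π(ε_K)` as a finite coset average).
* [BernsteinZelevinsky1976] I. N. Bernstein, A. V. Zelevinsky, Russian Math. Surveys 31 (1976), §2.1 (smooth and admissible representations).
* [Dixmier1977] J. Dixmier, *C\*-algebras* (1977), §2.3 (invariant subspaces and projections).
-/

set_option autoImplicit false
-- the mandated namespace has the single-problem summit's repeated segment (`HodgeConjecture.HodgeConjecture`)
set_option linter.dupNamespace false

noncomputable section

open Matrix MeasureTheory NumberField NumberField.InfinitePlace Metric Filter Topology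
open scoped Matrix ComplexConjugate ComplexOrder InnerProductSpace BoundedContinuousFunction
open Literature.NumberTheory.Automorphic Literature.NumberTheory.Automorphic.UnitaryGroup
open Literature.NumberTheory.Automorphic.UnitaryGroup.CotangentForms (toQuotFun toQuotFun_mk)
open Literature.NumberTheory.Automorphic.UnitaryCurveForms
open Literature.AlgebraicGeometry.ShimuraVarieties
open Summit.HodgeConjecture.HodgeConjecture.Cruxes.H413.SpectrumJunction
open Summit.HodgeConjecture.HodgeConjecture.Cruxes.HLiu418.E2Density
open Summit.HodgeConjecture.HodgeConjecture.Cruxes.HLiu418.E2LevelFinite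
open Summit.HodgeConjecture.HodgeConjecture.Cruxes.HLiu418.E2ArchOrthHolPrep (memLp_toQuotFun_self)

namespace Summit.HodgeConjecture.HodgeConjecture.Cruxes.HLiu418.E1pLevel

variable {F E : Type} [Field F] [NumberField F] [Field E] [NumberField E] [Algebra F E]
  {c : E ≃ₐ[F] E} {J : Matrix (Fin 2) (Fin 2) E}
  {hc : c ≠ 1} {hfix : ∀ w : InfinitePlace E, c • w = w} {w₁ : {w : InfinitePlace E // IsComplex w}} {𝔣 : ConeFrame E J w₁}
  {μ : Measure (adelicGroupData F E c 2 J).automorphicQuotient} [(adelicGroupData F E c 2 J).IsAutomorphicMeasure μ]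
  [CompactSpace (adelicGroupData F E c 2 J).automorphicQuotient]

/-! ## §1 (L0) The class map of a space of cone-holomorphic cotangent forms -/

/-- **(L0) `exists_clsMapN`.**  For a subspace `N ≤ holCotForms₂ … 𝔣`, the class map `Λ f := [toQuotFun f] ∈ L²(U(J)(F)\U(J)(𝔸_F), μ)`
(★ `memLp_toQuotFun_self`) is a LINEAR map `N → L²` that (i) is the `L²`-class on the nose for every `MemLp` witness, (ii) is INJECTIVE
(★ `toLp_toQuotFun_ne_zero`: the forms are continuous and `μ` is positive on opens) and (iii) intertwines right translation `rightRep₂` on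
`N` with the regular representation `R(1, g)` (★ `toLp_toQuotFun_mul_right`).  Pattern ★ `E2Bootstrap.exists_clsMap₂`.
[cite: BorelJacquet1979, §4.6] -/
theorem exists_clsMapN (N : Submodule ℂ ((adelicGroupData F E c 2 J).Adelic → ℂ)) (hN : N ≤ holCotForms₂ F E c J hc hfix w₁ 𝔣) :
    ∃ Λ : N →ₗ[ℂ] (adelicGroupData F E c 2 J).L2 μ,
      (∀ (f : N) (h : MemLp (toQuotFun (adelicGroupData F E c 2 J) (f : (adelicGroupData F E c 2 J).Adelic → ℂ)) 2 μ),
          Λ f = h.toLp (toQuotFun (adelicGroupData F E c 2 J) (f : (adelicGroupData F E c 2 J).Adelic → ℂ))) ∧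
      Function.Injective Λ ∧
      ∀ (g : finAdelic F E c 2 J) (f : N) (hg : rightRep₂ F E c J g (f : (adelicGroupData F E c 2 J).Adelic → ℂ) ∈ N),
        Λ ⟨_, hg⟩ = (adelicGroupData F E c 2 J).rightRegular μ (finAdelicToAdelic F E c 2 J g) (Λ f) := by
  have hmem : ∀ f : N, MemLp (toQuotFun (adelicGroupData F E c 2 J) (f : (adelicGroupData F E c 2 J).Adelic → ℂ)) 2 μ :=
    fun f => memLp_toQuotFun_self (μ := μ) (hN f.2)
  let Λ : N →ₗ[ℂ] (adelicGroupData F E c 2 J).L2 μ :=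
    { toFun := fun f => (hmem f).toLp (toQuotFun (adelicGroupData F E c 2 J) (f : (adelicGroupData F E c 2 J).Adelic → ℂ))
      map_add' := fun f f' => by
        change (hmem (f + f')).toLp _ = (hmem f).toLp _ + (hmem f').toLp _
        rw [← MemLp.toLp_add]
        exact MemLp.toLp_congr _ _ (Filter.EventuallyEq.of_eq
          (funext fun y => by simp only [toQuotFun, Submodule.coe_add, Pi.add_apply]))
      map_smul' := fun r f => by
        change (hmem (r • f)).toLp _ = r • (hmem f).toLp _
        rw [← MemLp.toLp_const_smul]
        exact MemLp.toLp_congr _ _ (Filter.EventuallyEq.of_eq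
          (funext fun y => by simp only [toQuotFun, Submodule.coe_smul, Pi.smul_apply, smul_eq_mul])) }
  have hΛ : ∀ f : N, Λ f = (hmem f).toLp (toQuotFun (adelicGroupData F E c 2 J) (f : (adelicGroupData F E c 2 J).Adelic → ℂ)) :=
    fun _ => rfl
  refine ⟨Λ, fun f h => hΛ f, fun f f' hff' => ?_, fun g f hg => ?_⟩
  · -- injectivity: the class of the continuous left-invariant `f − f'` vanishes, so `f − f' = 0`
    have h0 : Λ (f - f') = 0 := by rw [map_sub, hff', sub_self]
    by_contra hne
    have hne' : ((f - f' : N) : (adelicGroupData F E c 2 J).Adelic → ℂ) ≠ 0 := fun h =>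
      hne (sub_eq_zero.mp (Subtype.ext (h.trans (Submodule.coe_zero (p := N)).symm)))
    exact toLp_toQuotFun_ne_zero (leftInvariant_of_mem_holCotForms₂ (hN (f - f').2))
      (continuous_of_mem_holCotForms₂ F E c J hc hfix w₁ 𝔣 (hN (f - f').2)) (hmem (f - f')) hne' ((hΛ _).symm.trans h0)
  · -- equivariance: `[R_g f] = R(1, g) [f]`
    rw [hΛ, hΛ]
    have hfun : toQuotFun (adelicGroupData F E c 2 J) (rightRep₂ F E c J g (f : (adelicGroupData F E c 2 J).Adelic → ℂ)) =
        toQuotFun (adelicGroupData F E c 2 J) fun x => (f : (adelicGroupData F E c 2 J).Adelic → ℂ) (x * finAdelicToAdelic F E c 2 J g) := by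
      funext y
      simp only [toQuotFun, rightRep₂_apply]
    have hmemh : MemLp (toQuotFun (adelicGroupData F E c 2 J) fun x =>
        (f : (adelicGroupData F E c 2 J).Adelic → ℂ) (x * finAdelicToAdelic F E c 2 J g)) 2 μ := hfun ▸ hmem ⟨_, hg⟩
    rw [show (hmem ⟨_, hg⟩).toLp _ = hmemh.toLp _ from MemLp.toLp_congr _ _ (Filter.EventuallyEq.of_eq hfun)]
    exact toLp_toQuotFun_mul_right (leftInvariant_of_mem_holCotForms₂ (hN f.2)) _ (hmem f) hmemh

/-! ## §2 (L1) Level finiteness from the frame hypotheses -/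

/-- **(L1) `finite_holCotForms₂_inf_fixedPoints_of_frame` — LEVEL FINITENESS.**  For a cone frame with `⟪v₀,t₀⟫ = 0`, `⟪v₀,v₀⟫ = −r⟪t₀,t₀⟫`
(`r > 0`) on a compact automorphic quotient and an OPEN subgroup `K ≤ U(J)(𝔸_{F,f})`, the space of `K`-fixed cone-holomorphic cotangent
forms `holCotForms₂ … 𝔣 ⊓ Fix K` is FINITE-DIMENSIONAL: `f ↦ toQuotFun f` is an injective linear map into `C(X)` (★ `apply_eq_toQuotFun`)
whose unit ball lies in the totally bounded family of ★ `E2LevelFinite.totallyBounded_levelForms`, so Riesz applies.  No hermitian binder.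
[cite: Borel1997, §8] [cite: BorelJacquet1979, §4.2] [cite: BernsteinZelevinsky1976, §2.1] -/
theorem finite_holCotForms₂_inf_fixedPoints_of_frame (hvt : star 𝔣.v₀ ⬝ᵥ (J.map w₁.1.embedding *ᵥ 𝔣.t₀) = 0) {r : ℝ} (hr : 0 < r)
    (hvv : star 𝔣.v₀ ⬝ᵥ (J.map w₁.1.embedding *ᵥ 𝔣.v₀) = -(r : ℂ) * (star 𝔣.t₀ ⬝ᵥ (J.map w₁.1.embedding *ᵥ 𝔣.t₀)))
    {K : Subgroup (finAdelic F E c 2 J)} (hKo : IsOpen (K : Set (finAdelic F E c 2 J))) :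
    Module.Finite ℂ ↥(holCotForms₂ F E c J hc hfix w₁ 𝔣 ⊓ (rightRep₂ F E c J).fixedPoints K) := by
  set V : Submodule ℂ ((adelicGroupData F E c 2 J).Adelic → ℂ) := holCotForms₂ F E c J hc hfix w₁ 𝔣 ⊓ (rightRep₂ F E c J).fixedPoints K
    with hVdef
  have hV : ∀ f : V, (f : (adelicGroupData F E c 2 J).Adelic → ℂ) ∈ holCotForms₂ F E c J hc hfix w₁ 𝔣 := fun f => (Submodule.mem_inf.1 f.2).1
  have hVK : ∀ (f : V), ∀ k ∈ K, ∀ x, (f : (adelicGroupData F E c 2 J).Adelic → ℂ) (x * finAdelicToAdelic F E c 2 J k) =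
      (f : (adelicGroupData F E c 2 J).Adelic → ℂ) x := by
    intro f k hk x
    have hfK := (Representation.mem_fixedPoints _ _ _).1 (Submodule.mem_inf.1 f.2).2 k hk
    exact ((rightRep₂_apply F E c J k _ x).symm.trans (congrFun hfK x))
  -- continuity and left invariance of the members
  have hL : ∀ f : V, ∀ γ ∈ (adelicGroupData F E c 2 J).quotientSubgroup, ∀ x,
      (f : (adelicGroupData F E c 2 J).Adelic → ℂ) (γ * x) = (f : (adelicGroupData F E c 2 J).Adelic → ℂ) x :=
    fun f => leftInvariant_of_mem_holCotForms₂ (hV f)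
  have hC : ∀ f : V, Continuous (toQuotFun (adelicGroupData F E c 2 J) (f : (adelicGroupData F E c 2 J).Adelic → ℂ)) :=
    fun f => continuous_toQuotFun (hL f) (continuous_of_mem_holCotForms₂ F E c J hc hfix w₁ 𝔣 (hV f))
  -- the linear map `T : V → C(X)`
  let T : V →ₗ[ℂ] ((adelicGroupData F E c 2 J).automorphicQuotient →ᵇ ℂ) :=
    { toFun := fun f => BoundedContinuousFunction.mkOfCompact
        ⟨toQuotFun (adelicGroupData F E c 2 J) (f : (adelicGroupData F E c 2 J).Adelic → ℂ), hC f⟩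
      map_add' := fun f f' => by
        ext ξ
        simp only [BoundedContinuousFunction.mkOfCompact_apply, ContinuousMap.coe_mk, BoundedContinuousFunction.coe_add, Pi.add_apply,
          Submodule.coe_add, toQuotFun]
      map_smul' := fun r' f => by
        ext ξ
        simp only [BoundedContinuousFunction.mkOfCompact_apply, ContinuousMap.coe_mk, BoundedContinuousFunction.coe_smul, Pi.smul_apply,
          Submodule.coe_smul, RingHom.id_apply, toQuotFun, smul_eq_mul] }
  have hTapp : ∀ (f : V) ξ, T f ξ = toQuotFun (adelicGroupData F E c 2 J) (f : (adelicGroupData F E c 2 J).Adelic → ℂ) ξ :=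
    fun _ _ => rfl
  have hTinj : Function.Injective T := by
    intro f f' hff'
    apply Subtype.ext
    funext y
    rw [apply_eq_toQuotFun (hL f) y, apply_eq_toQuotFun (hL f') y, ← hTapp, ← hTapp, hff']
  -- the unit ball of `range T` lies in the totally bounded family of ★ `totallyBounded_levelForms`
  have htb : TotallyBounded (closedBall (0 : LinearMap.range T) 1) := by
    refine (totallyBounded_preimage isometry_subtype_coe.isUniformInducing
      (totallyBounded_levelForms (hc := hc) (hfix := hfix) hvt hr hvv hKo)).subset ?_
    rintro ⟨g, ⟨f, rfl⟩⟩ hg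
    rw [mem_closedBall, dist_zero_right] at hg
    refine ⟨(f : (adelicGroupData F E c 2 J).Adelic → ℂ), hV f, fun k hk x => hVK f k hk x, fun y => ?_, funext fun ξ => hTapp f ξ⟩
    rw [apply_eq_toQuotFun (hL f) y, ← hTapp]
    exact (BoundedContinuousFunction.norm_coe_le_norm (T f) _).trans hg
  haveI : FiniteDimensional ℂ (LinearMap.range T) :=
    FiniteDimensional.of_totallyBounded_nhds_zero ℂ (closedBall_mem_nhds (0 : LinearMap.range T) one_pos) htb
  exact Module.Finite.equiv (LinearEquiv.ofInjective T hTinj).symm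

/-! ## §3 (L2) `K`-fixed vectors of the closure of `Λ(N)` are classes of `K`-fixed forms of `N` -/

omit [(adelicGroupData F E c 2 J).IsAutomorphicMeasure μ] [CompactSpace (adelicGroupData F E c 2 J).automorphicQuotient] in
/-- The stabiliser in `U(J)(𝔸_{F,f})` of a cone-holomorphic cotangent form under `rightRep₂` is OPEN (clause (Sm): it contains an open
subgroup fixing the form). [cite: BorelJacquet1979, §4.2] [cite: BernsteinZelevinsky1976, §2.1] -/
theorem isOpen_stabilizerSubgroup_of_mem_holCotForms₂ {h : (adelicGroupData F E c 2 J).Adelic → ℂ}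
    (hh : h ∈ holCotForms₂ F E c J hc hfix w₁ 𝔣) :
    IsOpen ((rightRep₂ F E c J).stabilizerSubgroup h : Set (finAdelic F E c 2 J)) := by
  obtain ⟨-, -, ⟨Kf, hKo, hKf⟩, -⟩ := hh
  refine Subgroup.isOpen_mono (H₁ := Kf) (fun k hk => ?_) hKo
  rw [Representation.mem_stabilizerSubgroup]
  funext x
  rw [rightRep₂_apply]
  exact hKf k hk x

omit [(adelicGroupData F E c 2 J).IsAutomorphicMeasure μ] [CompactSpace (adelicGroupData F E c 2 J).automorphicQuotient] in
/-- **Finite averaging into `N ∩ Fix K`.**  For `N ≤ holCotForms₂` stable under `rightRep₂`, a COMPACT subgroup `K` and `h ∈ N`: there are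
`n ≠ 0` and `t₁, …, tₙ ∈ K` with `A h := n⁻¹ Σᵢ R_{tᵢ} h ∈ N` fixed by `K` (★ `Literature.RepresentationTheory.exists_average_family` over a
transversal of `K ∕ (K ∩ Stab h)`, the stabiliser being open of finite index in the compact `K`). [cite: Bump1997, §4.2 Eq. (2.8)]
[cite: BorelJacquet1979, §4.2] -/
theorem exists_average_mem_fixed (N : Submodule ℂ ((adelicGroupData F E c 2 J).Adelic → ℂ)) (hN : N ≤ holCotForms₂ F E c J hc hfix w₁ 𝔣)
    (hNst : ∀ (g : finAdelic F E c 2 J), ∀ f ∈ N, rightRep₂ F E c J g f ∈ N)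
    {K : Subgroup (finAdelic F E c 2 J)} (hKc : IsCompact (K : Set (finAdelic F E c 2 J))) {h : (adelicGroupData F E c 2 J).Adelic → ℂ}
    (hh : h ∈ N) :
    ∃ (n : ℕ) (t : Fin n → finAdelic F E c 2 J), n ≠ 0 ∧ (∀ i, t i ∈ K) ∧
      ((n : ℂ)⁻¹ • ∑ i, rightRep₂ F E c J (t i) h) ∈ N ∧
      ∀ k ∈ K, rightRep₂ F E c J k ((n : ℂ)⁻¹ • ∑ i, rightRep₂ F E c J (t i) h) = (n : ℂ)⁻¹ • ∑ i, rightRep₂ F E c J (t i) h := by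
  haveI : CompactSpace K := isCompact_iff_compactSpace.mp hKc
  haveI : Finite (K ⧸ ((rightRep₂ F E c J).stabilizerSubgroup h).subgroupOf K) :=
    Subgroup.quotient_finite_of_isOpen _ (Subgroup.subgroupOf_isOpen K _ (isOpen_stabilizerSubgroup_of_mem_holCotForms₂ (hN hh)))
  haveI : (((rightRep₂ F E c J).stabilizerSubgroup h).subgroupOf K).FiniteIndex := Subgroup.finiteIndex_of_finite_quotient
  obtain ⟨n, t, hn, ht, -, hPinv⟩ :=
    Literature.RepresentationTheory.exists_average_family (rightRep₂ F E c J) K ((rightRep₂ F E c J).stabilizerSubgroup h)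
  refine ⟨n, t, hn, ht, ?_, fun k hk => ?_⟩
  · exact N.smul_mem _ (N.sum_mem fun i _ => hNst (t i) h hh)
  · have hfixh : ∀ g ∈ (rightRep₂ F E c J).stabilizerSubgroup h, rightRep₂ F E c J g h = h :=
      fun g hg => (Representation.mem_stabilizerSubgroup _ _ _).1 hg
    have := hPinv h hfixh k hk
    simpa only [LinearMap.smul_apply, LinearMap.coe_sum, Finset.sum_apply] using this

omit [(adelicGroupData F E c 2 J).IsAutomorphicMeasure μ] [CompactSpace (adelicGroupData F E c 2 J).automorphicQuotient] in
/-- (H2) in the form used below: if EVERY vector of a subspace `M ≤ L²` with orthogonal projection is fixed by `R(g)` for all `g` in a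
subgroup `T ≤ U(J)(𝔸_F)`, then `pr_M (R(g) y) = R(g) (pr_M y)` for `g ∈ T` (unitarity: `R(g) y − R(g) pr_M y = R(g)(y − pr_M y) ⊥ M` since
`R(g⁻¹)` fixes `M`; Mathlib `Submodule.eq_starProjection_of_mem_of_inner_eq_zero`).  The general statement is ★
`E1pHilbert.starProjection_rightRegular_comm`. [cite: Dixmier1977, §2.3] [cite: BorelJacquet1979, §4.6] -/
private theorem starProjection_comm_of_forall_fixed [SMulInvariantMeasure (adelicGroupData F E c 2 J).Adelic
      (adelicGroupData F E c 2 J).automorphicQuotient μ]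
    (M : Submodule ℂ ((adelicGroupData F E c 2 J).L2 μ)) [M.HasOrthogonalProjection] (T : Subgroup (adelicGroupData F E c 2 J).Adelic)
    (hM : ∀ g ∈ T, ∀ m ∈ M, (adelicGroupData F E c 2 J).rightRegular μ g m = m) {g : (adelicGroupData F E c 2 J).Adelic} (hg : g ∈ T)
    (y : (adelicGroupData F E c 2 J).L2 μ) :
    M.starProjection ((adelicGroupData F E c 2 J).rightRegular μ g y) = (adelicGroupData F E c 2 J).rightRegular μ g (M.starProjection y) := by
  refine Submodule.eq_starProjection_of_mem_of_inner_eq_zero ?_ fun w hw => ?_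
  · rw [hM g hg _ (M.starProjection_apply_mem y)]
    exact M.starProjection_apply_mem y
  · have hw' : (adelicGroupData F E c 2 J).rightRegular μ g⁻¹ w = w := hM g⁻¹ (T.inv_mem hg) w hw
    have key : (adelicGroupData F E c 2 J).rightRegular μ g y - (adelicGroupData F E c 2 J).rightRegular μ g (M.starProjection y) =
        (adelicGroupData F E c 2 J).rightRegular μ g (y - M.starProjection y) := by rw [map_sub]
    rw [key, ← ((adelicGroupData F E c 2 J).isUnitary_rightRegular μ).inner_map_map g⁻¹, ← mul_apply_eq_comp, ← map_mul, inv_mul_cancel,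
      map_one, one_apply_eq_self, hw']
    exact Submodule.starProjection_inner_eq_zero y _ hw

/-- **(L2) `exists_eq_clsMap_of_mem_closure_of_fixed`.**  For `N ≤ holCotForms₂ … 𝔣` stable under `rightRep₂`, its class map `Λ` (any linear
map agreeing with `f ↦ [toQuotFun f]`, e.g. (L0)), an open COMPACT `K ≤ U(J)(𝔸_{F,f})` and a vector `y` in the CLOSURE of `Λ(N)` FIXED by
`R(1, K)`: `y = Λ f` for a `K`-fixed `f ∈ N`.  (Orthogonal decomposition of `y` against the finite-dimensional `M := Λ(N ∩ Fix K)` (L1); the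
remainder is `K`-fixed, in the closure, and orthogonal to every `Λ h`, `h ∈ N`, by the finite averaging `exists_average_mem_fixed` and
unitarity of `R`; hence it vanishes.)  [cite: Borel1997, §8] [cite: Bump1997, §4.2 Eq. (2.8)] [cite: BorelJacquet1979, §4.6]
[cite: Dixmier1977, §2.3] -/
theorem exists_eq_clsMap_of_mem_closure_of_fixed (hvt : star 𝔣.v₀ ⬝ᵥ (J.map w₁.1.embedding *ᵥ 𝔣.t₀) = 0) {r : ℝ} (hr : 0 < r)
    (hvv : star 𝔣.v₀ ⬝ᵥ (J.map w₁.1.embedding *ᵥ 𝔣.v₀) = -(r : ℂ) * (star 𝔣.t₀ ⬝ᵥ (J.map w₁.1.embedding *ᵥ 𝔣.t₀)))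
    (N : Submodule ℂ ((adelicGroupData F E c 2 J).Adelic → ℂ)) (hN : N ≤ holCotForms₂ F E c J hc hfix w₁ 𝔣)
    (hNst : ∀ (g : finAdelic F E c 2 J), ∀ f ∈ N, rightRep₂ F E c J g f ∈ N) (Λ : N →ₗ[ℂ] (adelicGroupData F E c 2 J).L2 μ)
    (hΛ : ∀ (f : N) (h : MemLp (toQuotFun (adelicGroupData F E c 2 J) (f : (adelicGroupData F E c 2 J).Adelic → ℂ)) 2 μ),
        Λ f = h.toLp (toQuotFun (adelicGroupData F E c 2 J) (f : (adelicGroupData F E c 2 J).Adelic → ℂ)))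
    {K : Subgroup (finAdelic F E c 2 J)} (hKo : IsOpen (K : Set (finAdelic F E c 2 J))) (hKc : IsCompact (K : Set (finAdelic F E c 2 J)))
    {y : (adelicGroupData F E c 2 J).L2 μ} (hy : y ∈ (LinearMap.range Λ).topologicalClosure)
    (hyK : ∀ k ∈ K, (adelicGroupData F E c 2 J).rightRegular μ (finAdelicToAdelic F E c 2 J k) y = y) :
    ∃ f : N, (∀ k ∈ K, rightRep₂ F E c J k (f : (adelicGroupData F E c 2 J).Adelic → ℂ) = f) ∧ y = Λ f := by
  -- abbreviations
  have hmem : ∀ f : N, MemLp (toQuotFun (adelicGroupData F E c 2 J) (f : (adelicGroupData F E c 2 J).Adelic → ℂ)) 2 μ :=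
    fun f => memLp_toQuotFun_self (μ := μ) (hN f.2)
  have hΛ' : ∀ f : N, Λ f = (hmem f).toLp (toQuotFun (adelicGroupData F E c 2 J) (f : (adelicGroupData F E c 2 J).Adelic → ℂ)) :=
    fun f => hΛ f (hmem f)
  -- (a) equivariance of `Λ`: `Λ (R_g f) = R(1,g) (Λ f)`
  have hΛeq : ∀ (g : finAdelic F E c 2 J) (f : N),
      Λ ⟨_, hNst g _ f.2⟩ = (adelicGroupData F E c 2 J).rightRegular μ (finAdelicToAdelic F E c 2 J g) (Λ f) := by
    intro g f
    rw [hΛ', hΛ']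
    have hfun : toQuotFun (adelicGroupData F E c 2 J) (rightRep₂ F E c J g (f : (adelicGroupData F E c 2 J).Adelic → ℂ)) =
        toQuotFun (adelicGroupData F E c 2 J) fun x => (f : (adelicGroupData F E c 2 J).Adelic → ℂ) (x * finAdelicToAdelic F E c 2 J g) := by
      funext z
      simp only [toQuotFun, rightRep₂_apply]
    have hmemh : MemLp (toQuotFun (adelicGroupData F E c 2 J) fun x =>
        (f : (adelicGroupData F E c 2 J).Adelic → ℂ) (x * finAdelicToAdelic F E c 2 J g)) 2 μ := hfun ▸ hmem ⟨_, hNst g _ f.2⟩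
    rw [show (hmem ⟨_, hNst g _ f.2⟩).toLp _ = hmemh.toLp _ from MemLp.toLp_congr _ _ (Filter.EventuallyEq.of_eq hfun)]
    exact toLp_toQuotFun_mul_right (leftInvariant_of_mem_holCotForms₂ (hN f.2)) _ (hmem f) hmemh
  -- (b) the `K`-fixed part `V_K` of `N` and its image `M`, a finite-dimensional subspace of `L²`
  let VK : Submodule ℂ N := ((rightRep₂ F E c J).fixedPoints K).comap N.subtype
  have memVK : ∀ f : N, f ∈ VK ↔ ∀ k ∈ K, rightRep₂ F E c J k (f : (adelicGroupData F E c 2 J).Adelic → ℂ) = f := fun f => by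
    change (f : (adelicGroupData F E c 2 J).Adelic → ℂ) ∈ (rightRep₂ F E c J).fixedPoints K ↔ _
    rw [Representation.mem_fixedPoints]
  haveI hfinV : Module.Finite ℂ VK := by
    -- `VK` embeds linearly into `holCotForms₂ ⊓ Fix K`, finite-dimensional by (L1)
    haveI := finite_holCotForms₂_inf_fixedPoints_of_frame (hc := hc) (hfix := hfix) hvt hr hvv hKo
    let ι : VK →ₗ[ℂ] ↥(holCotForms₂ F E c J hc hfix w₁ 𝔣 ⊓ (rightRep₂ F E c J).fixedPoints K) :=
      { toFun := fun f => ⟨((f : N) : (adelicGroupData F E c 2 J).Adelic → ℂ), Submodule.mem_inf.2 ⟨hN (f : N).2, f.2⟩⟩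
        map_add' := fun _ _ => rfl
        map_smul' := fun _ _ => rfl }
    have hι : Function.Injective ι := by
      intro f f' hff'
      apply Subtype.ext
      apply Subtype.ext
      exact congrArg (fun z : ↥(holCotForms₂ F E c J hc hfix w₁ 𝔣 ⊓ (rightRep₂ F E c J).fixedPoints K) =>
        (z : (adelicGroupData F E c 2 J).Adelic → ℂ)) hff'
    exact Module.Finite.of_injective ι hι
  let M : Submodule ℂ ((adelicGroupData F E c 2 J).L2 μ) := VK.map Λ
  haveI : FiniteDimensional ℂ M := Module.Finite.map _ _
  haveI : M.HasOrthogonalProjection := Submodule.HasOrthogonalProjection.ofCompleteSpace M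
  have memM : ∀ {m : (adelicGroupData F E c 2 J).L2 μ}, m ∈ M ↔ ∃ f : N, f ∈ VK ∧ Λ f = m := fun {m} => Submodule.mem_map
  -- every vector of `M` is `K`-fixed; in particular `M` is `R(1,K)`-stable
  have hMfix : ∀ m ∈ M, ∀ k ∈ K, (adelicGroupData F E c 2 J).rightRegular μ (finAdelicToAdelic F E c 2 J k) m = m := by
    intro m hm k hk
    obtain ⟨f, hf, rfl⟩ := memM.1 hm
    have hkf : rightRep₂ F E c J k (f : (adelicGroupData F E c 2 J).Adelic → ℂ) = f := (memVK f).1 hf k hk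
    have h1 := hΛeq k f
    have h2 : (⟨_, hNst k _ f.2⟩ : N) = f := Subtype.ext hkf
    rw [h2] at h1
    exact h1.symm
  have hMfixT : ∀ k ∈ K.map (finAdelicToAdelic F E c 2 J), ∀ m ∈ M, (adelicGroupData F E c 2 J).rightRegular μ k m = m := by
    rintro _ ⟨k, hk, rfl⟩ m hm
    exact hMfix m hm k hk
  -- (c) orthogonal decomposition `y = y₁ + y₂`, `y₁ = pr_M y`, `y₂ ⊥ M`
  set y₁ : (adelicGroupData F E c 2 J).L2 μ := M.starProjection y with hy₁
  set y₂ : (adelicGroupData F E c 2 J).L2 μ := y - y₁ with hy₂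
  have hy₁M : y₁ ∈ M := M.starProjection_apply_mem y
  have hy₂orth : y₂ ∈ Mᗮ := M.sub_starProjection_mem_orthogonal y
  -- `y₂` is `K`-fixed
  have hy₂K : ∀ k ∈ K, (adelicGroupData F E c 2 J).rightRegular μ (finAdelicToAdelic F E c 2 J k) y₂ = y₂ := by
    intro k hk
    have hcomm := starProjection_comm_of_forall_fixed (μ := μ) M (K.map (finAdelicToAdelic F E c 2 J)) hMfixT
      (g := finAdelicToAdelic F E c 2 J k) ⟨k, hk, rfl⟩ y
    rw [hyK k hk] at hcomm
    rw [hy₂, map_sub, hyK k hk, ← hcomm]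
  -- `y₂` lies in the closure of `range Λ`
  have hy₂cl : y₂ ∈ (LinearMap.range Λ).topologicalClosure := by
    have hy₁cl : y₁ ∈ (LinearMap.range Λ).topologicalClosure := by
      obtain ⟨f, -, hf⟩ := memM.1 hy₁M
      exact (LinearMap.range Λ).le_topologicalClosure ⟨f, hf⟩
    exact Submodule.sub_mem _ hy hy₁cl
  -- (d) `y₂` is orthogonal to every class `Λ h`, `h ∈ N` (finite averaging + unitarity)
  have hy₂perp : ∀ h : N, ⟪Λ h, y₂⟫_ℂ = 0 := by
    intro h
    obtain ⟨n, t, hn, ht, hAN, hAK⟩ := exists_average_mem_fixed (hc := hc) (hfix := hfix) (𝔣 := 𝔣) N hN hNst hKc h.2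
    set Ah : N := ⟨(n : ℂ)⁻¹ • ∑ i, rightRep₂ F E c J (t i) (h : (adelicGroupData F E c 2 J).Adelic → ℂ), hAN⟩ with hAh
    -- `Λ (A h) ∈ M`, hence `⟪Λ (A h), y₂⟫ = 0`
    have hAhVK : Ah ∈ VK := (memVK Ah).2 hAK
    have hAhM : Λ Ah ∈ M := memM.2 ⟨Ah, hAhVK, rfl⟩
    have h0 : ⟪Λ Ah, y₂⟫_ℂ = 0 := by
      rw [Submodule.mem_orthogonal] at hy₂orth
      exact hy₂orth _ hAhM
    -- `Λ (A h) = n⁻¹ Σ R(1,tᵢ) (Λ h)`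
    have hΛA : Λ Ah = (n : ℂ)⁻¹ • ∑ i, (adelicGroupData F E c 2 J).rightRegular μ (finAdelicToAdelic F E c 2 J (t i)) (Λ h) := by
      have hAh' : Ah = (n : ℂ)⁻¹ • ∑ i, (⟨_, hNst (t i) _ h.2⟩ : N) := by
        apply Subtype.ext
        simp only [hAh, Submodule.coe_smul, Submodule.coe_sum]
      rw [hAh', map_smul, map_sum]
      congr 1
      exact Finset.sum_congr rfl fun i _ => hΛeq (t i) h
    -- each summand pairs with `y₂` like `Λ h` (unitarity; `tᵢ ∈ K` fixes `y₂`)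
    have hsum : ⟪Λ Ah, y₂⟫_ℂ = ⟪Λ h, y₂⟫_ℂ := by
      rw [hΛA, inner_smul_left, sum_inner]
      have hterm : ∀ i, ⟪(adelicGroupData F E c 2 J).rightRegular μ (finAdelicToAdelic F E c 2 J (t i)) (Λ h), y₂⟫_ℂ = ⟪Λ h, y₂⟫_ℂ := by
        intro i
        conv_lhs => rw [← hy₂K (t i) (ht i)]
        exact ((adelicGroupData F E c 2 J).isUnitary_rightRegular μ).inner_map_map _ _ _
      simp only [hterm, Finset.sum_const, Finset.card_univ, Fintype.card_fin, nsmul_eq_mul]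
      have hn' : (n : ℂ) ≠ 0 := Nat.cast_ne_zero.2 hn
      rw [map_inv₀, Complex.conj_natCast, ← mul_assoc, inv_mul_cancel₀ hn', one_mul]
    rw [← hsum, h0]
  -- (e) hence `y₂ ⊥ closure (range Λ) ∋ y₂`, so `y₂ = 0`
  have hy₂zero : y₂ = 0 := by
    have hle : LinearMap.range Λ ≤ (ℂ ∙ y₂)ᗮ := by
      rintro _ ⟨h, rfl⟩
      rw [Submodule.mem_orthogonal_singleton_iff_inner_right]
      rw [← inner_conj_symm, hy₂perp h, map_zero]
    have hcl : (LinearMap.range Λ).topologicalClosure ≤ (ℂ ∙ y₂)ᗮ :=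
      Submodule.topologicalClosure_minimal _ hle (Submodule.isClosed_orthogonal _)
    have hself : ⟪y₂, y₂⟫_ℂ = 0 := (Submodule.mem_orthogonal_singleton_iff_inner_right.1 (hcl hy₂cl))
    exact inner_self_eq_zero.1 hself
  -- (f) conclusion: `y = y₁ ∈ M = Λ(N ∩ Fix K)`
  have hyM : y ∈ M := by
    have : y = y₁ := by rw [← sub_eq_zero]; exact hy₂zero
    rw [this]
    exact hy₁M
  obtain ⟨f, hf, hfy⟩ := memM.1 hyM
  exact ⟨f, (memVK f).1 hf, hfy.symm⟩

end Summit.HodgeConjecture.HodgeConjecture.Cruxes.HLiu418.E1pLevel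

end
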